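import Summits.CriticalPhenomena.PercolationContinuityZ3.Theorems.PercNearOneGluingNoHeavyLowerTailSahiGridPatternStarCertPrelim

/-!
# `NoHeavyLowerTail` (crux stmt-CriticalPhenomena-4575), Sahi programme P1: **THE STAR THEOREM FOR LITERAL BLOCKS** — every union
# `{∃ i ∈ T : x_i ≥ u_i} ∪ {x_S ≥ t}` of single-axis literals and one orthant (disjoint supports) has a diagonal certificate, in every dimension

Support file (Sahi cell, seat `prim-sahi-p1`, generation 22; `--supports stmt-CriticalPhenomena-4575`).  Pure proofs, no definitions,
no `sorry`, standard axioms.  Vocabulary of `…SahiGridPattern{CellForm,DiagCert,StarCertPrelim}`.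

THE MATHEMATICS.  Fix `K`, a marking `κ : Fin K → Bool` of LITERAL axes (`κ i = true`) and ORTHANT axes (`κ i = false`) with all literal
axes before all orthant axes, thresholds `thr : Fin K → [3]` (nonzero on literal axes) and a flag `w` (orthant block present or not).  The STAR
  `S = {x ∈ [3]^K : (∃ i literal, thr i ≤ x i) ∨ (w ∧ ∀ i orthant, thr i ≤ x i)}`
— an OR of threshold literals and (optionally) one AND of threshold literals on disjoint axes, i.e. the pattern of a read-once monotone DNF
with at most one term of width ≥ 2 — has a DIAGONAL CERTIFICATE (`star_literal_cert`), by induction on `K`: no literal axis ⇒ `S` is an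
orthant or `∅` (`diagCert_orthant`, `diagCert_empty`); otherwise axis `0` is a literal, `S = {x_0 ≥ thr 0} ∪ [3] × S'` with `S'` the star of
the remaining axes, and the certificate of `S'` (induction) is lifted by the threshold-1 step (`litOneAbsorb_cert`, generation 21's literal
absorption) or the threshold-2 step (`litTwoAbsorb_cert`, this generation's literal absorption with certificates), then moved from
`[3]^{1+K}` to `[3]^{K+1}` (`diagCert_transfer`).  CONSEQUENCES: `sStarD_starLiteral_nonneg` (`S` is a good first slot in its own dimension) and
`sStarD_cylSet_starLiteral_nonneg` (`S × [3]^m` good in every dimension).  General axis positions and the value-level corollary (Kahn's `E₃ ≥ 0`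
for `A` = clause ∨ monomial) are in the sequel `…StarLiteralGeneral`.  Nothing here asserts `PatternPos d` for `d ≥ 4`. [this work]
-/

namespace Summit.CriticalPhenomena.PercolationContinuityZ3.Theorems.SahiGridPattern

open Finset SahiGrid3
open scoped BigOperators

/-- The star of literal axes and one orthant block is an up-set. [this work] -/
theorem isUpperSet_starLiteral (K : ℕ) (κ : Fin K → Bool) (thr : Fin K → Fin 3) (w : Bool) :
    IsUpperSet ((univ.filter fun x : Pd K => (∃ i, κ i = true ∧ thr i ≤ x i) ∨ (w = true ∧ ∀ i, κ i = false → thr i ≤ x i)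
      : Finset (Pd K)) : Set (Pd K)) := by
  intro x y hxy hx
  rw [Finset.mem_coe, Finset.mem_filter] at hx ⊢
  refine ⟨Finset.mem_univ _, ?_⟩
  rcases hx.2 with ⟨i, hi, ht⟩ | ⟨hw, h⟩
  · exact Or.inl ⟨i, hi, le_trans ht (hxy i)⟩
  · exact Or.inr ⟨hw, fun i hi => le_trans (h i hi) (hxy i)⟩

/-- Coordinates of a point of `[3]^{K+1}` re-indexed to `[3]^{1+K}`: the head. [this work] -/
theorem comp_finCongr_castAdd {K : ℕ} (p : Pd (K + 1)) :
    (p ∘ (finCongr (Nat.add_comm 1 K))) (Fin.castAdd K (0 : Fin 1)) = p 0 := by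
  simp only [Function.comp_apply]
  congr 1

/-- Coordinates of a point of `[3]^{K+1}` re-indexed to `[3]^{1+K}`: the tail is the cell. [this work] -/
theorem cellOf_comp_finCongr {K : ℕ} (p : Pd (K + 1)) :
    cellOf (n := 1) (p ∘ (finCongr (Nat.add_comm 1 K))) = fun j : Fin K => p (Fin.succ j) := by
  funext j
  simp only [cellOf, Function.comp_apply]
  congr 1
  ext
  simp

/-- **EVERY STAR OF LITERAL AXES AND ONE ORTHANT BLOCK HAS A DIAGONAL CERTIFICATE** (every `K`; literal axes first, literal thresholds
nonzero). [this work] -/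
theorem star_literal_cert : ∀ (K : ℕ) (κ : Fin K → Bool) (thr : Fin K → Fin 3) (w : Bool),
    (∀ i, κ i = true → thr i ≠ 0) → (∀ i j, κ i = true → κ j = false → i < j) →
    ∃ c : Pd K → ℤ, (∀ q, 0 ≤ c q) ∧
      (∀ W : Finset (Pd K), IsUpperSet (W : Set (Pd K)) → (∑ q ∈ W, c q) ≤ ∑ q ∈ W,
        lamU (univ.filter fun x : Pd K => (∃ i, κ i = true ∧ thr i ≤ x i) ∨ (w = true ∧ ∀ i, κ i = false → thr i ≤ x i)) q) ∧
      (∀ A A' : Finset (Pd K), IsUpperSet (A : Set (Pd K)) → IsUpperSet (A' : Set (Pd K)) →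
        (∑ q ∈ A, ∑ r ∈ A', thetaVal (univ.filter fun x : Pd K => (∃ i, κ i = true ∧ thr i ≤ x i)
          ∨ (w = true ∧ ∀ i, κ i = false → thr i ≤ x i)) q r) ≤ ∑ q ∈ A ∩ A', c q) := by
  intro K
  induction K with
  | zero =>
    intro κ thr w _ _
    by_cases hw : w = true
    · -- the whole (one-point) cube: an orthant with threshold `0`
      have e : (univ.filter fun x : Pd 0 => (∃ i, κ i = true ∧ thr i ≤ x i) ∨ (w = true ∧ ∀ i, κ i = false → thr i ≤ x i))
          = univ.filter fun x : Pd 0 => ∀ a, (fun _ => (0 : Fin 3)) a ≤ x a := by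
        ext x; simp only [Finset.mem_filter, Finset.mem_univ, true_and]
        exact ⟨fun _ a => Fin.elim0 a, fun _ => Or.inr ⟨hw, fun i => Fin.elim0 i⟩⟩
      obtain ⟨h1, h2, h3⟩ := diagCert_orthant (k := 0) (fun _ => (0 : Fin 3))
      exact ⟨_, h1, fun W hW => by rw [e]; exact h2 W hW, fun A A' hA hA' => by rw [e]; exact h3 A A' hA hA'⟩
    · have e : (univ.filter fun x : Pd 0 => (∃ i, κ i = true ∧ thr i ≤ x i) ∨ (w = true ∧ ∀ i, κ i = false → thr i ≤ x i)) = ∅ := by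
        ext x; simp only [Finset.mem_filter, Finset.mem_univ, true_and, Finset.notMem_empty, iff_false, not_or, not_exists, not_and]
        exact ⟨fun i => Fin.elim0 i, fun h => absurd h hw⟩
      obtain ⟨h1, h2, h3⟩ := diagCert_empty (k := 0)
      exact ⟨_, h1, fun W hW => by rw [e]; exact h2 W hW, fun A A' hA hA' => by rw [e]; exact h3 A A' hA hA'⟩
  | succ K ih =>
    intro κ thr w hthr hord
    by_cases h0 : κ 0 = true
    · -- axis 0 is a literal: peel it
      set κ' : Fin K → Bool := fun j => κ (Fin.succ j) with hκ'
      set thr' : Fin K → Fin 3 := fun j => thr (Fin.succ j) with hthr'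
      have hthr'' : ∀ i, κ' i = true → thr' i ≠ 0 := fun i hi => hthr _ hi
      have hord' : ∀ i j, κ' i = true → κ' j = false → i < j := fun i j hi hj => by
        have := hord _ _ hi hj; exact Fin.succ_lt_succ_iff.1 this
      obtain ⟨c', hc', hT', hN'⟩ := ih κ' thr' w hthr'' hord'
      set U' : Finset (Pd K) := univ.filter fun x : Pd K => (∃ i, κ' i = true ∧ thr' i ≤ x i)
        ∨ (w = true ∧ ∀ i, κ' i = false → thr' i ≤ x i) with hU'
      have hU'up : IsUpperSet (U' : Set (Pd K)) := by rw [hU']; exact isUpperSet_starLiteral K κ' thr' w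
      -- the two blocks in `[3]^{1+K}`
      set ℓ : Pd 1 := fun _ => thr 0 with hℓ
      set X : Finset (Pd (1 + K)) := univ.filter fun y : Pd (1 + K) => thr 0 ≤ y (Fin.castAdd K (0 : Fin 1)) with hXd
      set Y : Finset (Pd (1 + K)) := univ.filter fun y : Pd (1 + K) => cellOf (n := 1) y ∈ U' with hYd
      have hX : ∀ (ξ : Pd 1) (z : Pd K), glue ξ z ∈ X ↔ ξ ∈ (univ.filter fun y : Pd 1 => ∀ j, ℓ j ≤ y j) := by
        intro ξ z
        rw [hXd, Finset.mem_filter, Finset.mem_filter, glue_castAdd]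
        simp only [Finset.mem_univ, true_and, Fin.forall_fin_one, hℓ]
      have hY : ∀ (ξ : Pd 1) (z : Pd K), glue ξ z ∈ Y ↔ z ∈ U' := by
        intro ξ z; rw [hYd, Finset.mem_filter, cellOf_glue]; simp
      -- the certificate of `X ∪ Y`, by the literal step of the right threshold
      have hcert : ∃ c₁ : Pd (1 + K) → ℤ, (∀ x, 0 ≤ c₁ x) ∧
          (∀ W : Finset (Pd (1 + K)), IsUpperSet (W : Set (Pd (1 + K))) → (∑ x ∈ W, c₁ x) ≤ ∑ x ∈ W, lamU (X ∪ Y) x) ∧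
          (∀ A A' : Finset (Pd (1 + K)), IsUpperSet (A : Set (Pd (1 + K))) → IsUpperSet (A' : Set (Pd (1 + K))) →
            (∑ q ∈ A, ∑ r ∈ A', thetaVal (X ∪ Y) q r) ≤ ∑ x ∈ A ∩ A', c₁ x) := by
        have ht0 : thr 0 ≠ 0 := hthr 0 h0
        by_cases h2 : thr 0 = 2
        · have hℓ2 : ℓ 0 = 2 := by rw [hℓ]; exact h2
          obtain ⟨a1, a2, a3⟩ := litTwoAbsorb_cert ℓ hℓ2 hU'up c' hc' hT' hN' hX hY
          exact ⟨_, a1, a2, a3⟩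
        · have h1 : thr 0 = 1 := by
            have : ∀ u : Fin 3, u ≠ 0 → u ≠ 2 → u = 1 := by decide
            exact this _ ht0 h2
          have hℓ1 : ∀ i, ℓ i = 1 := fun _ => by rw [hℓ]; exact h1
          obtain ⟨a1, a2, a3⟩ := litOneAbsorb_cert ℓ hℓ1 hU'up hX hY
          exact ⟨_, a1, a2, a3⟩
      obtain ⟨c₁, hc₁, hT₁, hN₁⟩ := hcert
      -- transfer from `[3]^{1+K}` to `[3]^{K+1}`
      have hmem : ∀ p : Pd (K + 1), p ∈ (univ.filter fun x : Pd (K + 1) => (∃ i, κ i = true ∧ thr i ≤ x i)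
          ∨ (w = true ∧ ∀ i, κ i = false → thr i ≤ x i)) ↔ (p ∘ (finCongr (Nat.add_comm 1 K))) ∈ X ∪ Y := by
        intro p
        rw [Finset.mem_union, hXd, hYd, Finset.mem_filter, Finset.mem_filter, Finset.mem_filter, comp_finCongr_castAdd,
          cellOf_comp_finCongr, hU', Finset.mem_filter]
        simp only [Finset.mem_univ, true_and, hκ', hthr']
        constructor
        · rintro (⟨i, hi, hle⟩ | ⟨hw, hall⟩)
          · refine Fin.cases ?_ (fun j => ?_) i hi hle
            · intro _ hle; exact Or.inl hle
            · intro hj hle; exact Or.inr (Or.inl ⟨j, hj, hle⟩)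
          · exact Or.inr (Or.inr ⟨hw, fun j hj => hall _ hj⟩)
        · rintro (hle | ⟨j, hj, hle⟩ | ⟨hw, hall⟩)
          · exact Or.inl ⟨0, h0, hle⟩
          · exact Or.inl ⟨Fin.succ j, hj, hle⟩
          · refine Or.inr ⟨hw, fun i => Fin.cases ?_ (fun j => ?_) i⟩
            · intro hi; rw [h0] at hi; exact absurd hi (by decide)
            · intro hj; exact hall j hj
      obtain ⟨b1, b2, b3⟩ := diagCert_transfer (finCongr (Nat.add_comm 1 K)) hmem c₁ hc₁ hT₁ hN₁
      exact ⟨_, b1, b2, b3⟩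
    · -- no literal axis: an orthant or the empty set
      have hnone : ∀ i, κ i = false := by
        intro i
        by_cases hi : κ i = true
        · exact absurd (hord i 0 hi (by simpa using h0)) (by simp)
        · simpa using hi
      by_cases hw : w = true
      · have e : (univ.filter fun x : Pd (K + 1) => (∃ i, κ i = true ∧ thr i ≤ x i) ∨ (w = true ∧ ∀ i, κ i = false → thr i ≤ x i))
            = univ.filter fun x : Pd (K + 1) => ∀ a, thr a ≤ x a := by
          ext x; simp only [Finset.mem_filter, Finset.mem_univ, true_and]
          constructor
          · rintro (⟨i, hi, _⟩ | ⟨_, h⟩)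
            · rw [hnone i] at hi; exact absurd hi (by decide)
            · exact fun a => h a (hnone a)
          · intro h; exact Or.inr ⟨hw, fun a _ => h a⟩
        obtain ⟨h1, h2, h3⟩ := diagCert_orthant thr
        exact ⟨_, h1, fun W hW => by rw [e]; exact h2 W hW, fun A A' hA hA' => by rw [e]; exact h3 A A' hA hA'⟩
      · have e : (univ.filter fun x : Pd (K + 1) => (∃ i, κ i = true ∧ thr i ≤ x i) ∨ (w = true ∧ ∀ i, κ i = false → thr i ≤ x i)) = ∅ := by
          ext x
          simp only [Finset.mem_filter, Finset.mem_univ, true_and, Finset.notMem_empty, iff_false, not_or, not_exists, not_and]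
          exact ⟨fun i hi => by rw [hnone i] at hi; exact absurd hi (by decide), fun h => absurd h hw⟩
        obtain ⟨h1, h2, h3⟩ := diagCert_empty (k := K + 1)
        exact ⟨_, h1, fun W hW => by rw [e]; exact h2 W hW, fun A A' hA hA' => by rw [e]; exact h3 A A' hA hA'⟩

/-- **THE STAR OF LITERAL AXES AND ONE ORTHANT BLOCK IS A GOOD FIRST SLOT** in its own dimension: `0 ≤ sStarD S B C` for all up-sets
`B, C ⊆ [3]^K`. [this work] -/
theorem sStarD_starLiteral_nonneg (K : ℕ) (κ : Fin K → Bool) (thr : Fin K → Fin 3) (w : Bool)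
    (hthr : ∀ i, κ i = true → thr i ≠ 0) (hord : ∀ i j, κ i = true → κ j = false → i < j)
    {B C : Finset (Pd K)} (hB : IsUpperSet (B : Set (Pd K))) (hC : IsUpperSet (C : Set (Pd K))) :
    0 ≤ sStarD (univ.filter fun x : Pd K => (∃ i, κ i = true ∧ thr i ≤ x i) ∨ (w = true ∧ ∀ i, κ i = false → thr i ≤ x i)) B C := by
  obtain ⟨c, _, hT, hN⟩ := star_literal_cert K κ thr w hthr hord
  exact sStarD_nonneg_of_diagCert _ c hT hN hB hC

/-- **… AND IN EVERY DIMENSION**: `0 ≤ sStarD (S × [3]^m) B C` for all up-sets `B, C ⊆ [3]^{m+K}`. [this work] -/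
theorem sStarD_cylSet_starLiteral_nonneg {m : ℕ} (K : ℕ) (κ : Fin K → Bool) (thr : Fin K → Fin 3) (w : Bool)
    (hthr : ∀ i, κ i = true → thr i ≠ 0) (hord : ∀ i j, κ i = true → κ j = false → i < j)
    {B C : Finset (Pd (m + K))} (hB : IsUpperSet (B : Set (Pd (m + K)))) (hC : IsUpperSet (C : Set (Pd (m + K)))) :
    0 ≤ sStarD (cylSet (univ.filter fun x : Pd K => (∃ i, κ i = true ∧ thr i ≤ x i) ∨ (w = true ∧ ∀ i, κ i = false → thr i ≤ x i))
      : Finset (Pd (m + K))) B C := by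
  obtain ⟨c, hc, hT, hN⟩ := star_literal_cert K κ thr w hthr hord
  exact sStarD_cylSet_nonneg_of_diagCert _ c hc hT hN hB hC

end Summit.CriticalPhenomena.PercolationContinuityZ3.Theorems.SahiGridPattern
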